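import Mathlib.Algebra.MvPolynomial.PDeriv
import Mathlib.Algebra.MvPolynomial.CommRing
import Mathlib.RingTheory.MvPolynomial.Basic
import Mathlib.RingTheory.Ideal.Span
import Mathlib.Data.Fin.VecNotation
import Mathlib.Tactic
import HarnessLib
import Summits.ResolutionOfSingularities.ResolutionOfSingularities.Theorems.MarkedTransferCampaignW32WQTopLocus

/-!
# Kill test K3.5 (LADDER-RESOLUTION rung L, slot W3.5 «stratum-first regular cut»): the first point blow-up of the W-Q
# hypersurface `fW` at the origin — transform identity, tangential triviality of the whole exceptional hyperplane, the lifted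
# curve `γ′`, and the local form at the generic exceptional point

Cell `res-hironaka`, seat `res-L1-k35` (prereg `L/res-L1-k35/PREREG-K3.5.md` dce0c70d178b4f87 frozen 2026-08-27T02:03:42Z;
report `L/res-L1-k35/KILL-TEST-K3.5.md`; kit job j265670, canonical result sha16 46fe1cc076050220). HONEST FRAMING:
«[OURS · L1 W3.5] kill-test helper; NOT a statement of the manuscript.» Every declaration below is an explicit polynomial
identity in `R[x₁,y,z₁,w₁,v₁] = MvPolynomial (Fin 5) R` over an ARBITRARY commutative ring `R` (characteristic 2 enters only
through displayed integer factors), an ideal membership read off such an identity, or a substitution identity. NOTHING here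
asserts a statement of H. Hironaka's manuscript (2017-03-23, [claim: Hironaka2017, status: under-review]); its clauses
(transform of an ideal exponent Def. 2.1 p.5; edge algebra Eq. (21) p.18, Def. 4.6–4.11 pp.19–21; `Inv` Eq. (34) p.24; §6.1–6.2
pp.29–30) are quoted for locators only. The glue from these certificates to «`Inv = (5,4,2)` at every closed point of the
exceptional hyperplane `exc₁ ∩ ℙ(x̄ = 0)`» is the hand lemma L-TT of the report §3 over FACT-LIST rows F-21d/F-21e/F-20a/F-09 —
not a kernel theorem.

Contents (`X 0,…,X 4 = x₁, y, z₁, w₁, v₁`, the coordinates of the `y`-chart of the blow-up of `𝔸⁵` at `0`: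
`x = x₁y, z = z₁y, w = w₁y, v = v₁y`; `fW = fW2` of the K3.2 helper file, `x² + wv⁶ + zw⁵v² + yz²wv⁴ + yz³w⁵ + yz⁹ + y⁴zw²v² + y¹¹`):
* §1 `chartY_fW2`: `fW(x₁y, y, z₁y, w₁y, v₁y) = y² · fW1` with `fW1 = x₁² + y⁵·H1`,
  `H1 = w₁v₁⁶ + y(z₁w₁⁵v₁² + z₁²w₁v₁⁴) + y²(z₁³w₁⁵ + z₁w₁²v₁²) + y³z₁⁹ + y⁴` — the transform `(fW1, 2)` of `(fW, 2)` in this chart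
  (Def. 2.1: `J𝒪_{Z′} = I(exc)²·J′`), exceptional divisor `{y = 0}`, exceptional exponent `a₁ = 5`;
* §2 `pderiv*_fW1`: `∂_{x₁} fW1 = 2x₁`, and `∂_y fW1`, `∂_{z₁} fW1`, `∂_{w₁} fW1`, `∂_{v₁} fW1` are multiples of `y⁴` — so at every
  point of the exceptional hyperplane `{y = x₁ = 0}` all first partials have order `≥ 4` (in characteristic 2, where `2x₁ = 0`):
  the hyperplane is TANGENTIALLY TRIVIAL and lies in the order-2 locus of `fW1` (report §3 (i), §4);
* §3 `gammaW1_*`: the lifted curve `γ′(s) = (s⁸¹, s¹⁸, s², s⁶, s¹¹)` maps to `γ(s) = (s⁹⁹, s¹⁸, s²⁰, s²⁴, s²⁹)` under the chart and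
  `fW1(γ′(s)) = 8·s¹⁶²` (`= 0` in characteristic 2): `γ′ ⊂ V(fW1)` passes through the origin `q₁` of the chart only;
* §4 `eval_H1_excPoint`, `eval_K1_excPoint`: at the exceptional point `q = (0, 0, a, b, c)` one has `H1(q) = bc⁶` and
  `(5H1 + y∂_yH1)(q) = 5bc⁶` — so, by §1–§2, `fW1 = x₁² + y⁵·(bc⁶ + …)` and `∂_y fW1 = y⁴·(5bc⁶ + …)` near `q`: the degree-5
  component `bc⁶·y⁵` (odd exponent: not a square) and the order-4 start of `∂_y` are the two numbers `d_np = 5 < 8 = 2τ_G` of the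
  report's generic cell where `bc ≠ 0` (the full cell table is the job's; here only these values are kernel-checked).

Host item: MarkedTransfer `HypersurfaceOrderReduction` (stmt-ResolutionOfSingularities-16155) `--as helper`, as for the K3.1/K3.2/K3.4
helpers. No new route, no new item.

## References
* H. Hironaka, ms. 2017-03-23 [Hironaka2017]: Def. 2.1 p.5, Eq. (21) p.18, Def. 4.6–4.11 pp.19–21, Eq. (34) p.24, §6.1–6.2 pp.29–30 —
  locators only.
* H. Hironaka, Three key theorems on infinitely near singularities, Sémin. Congr. 10 (2005) [Hironaka2005] — FACT-LIST F-21d/e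
  (`Literature.AlgebraicGeometry.Resolution.Hironaka2005.calP_eq_integralClosure_P`), used in the report, not here.
* Cell files `L/res-L1-k35/*K3.5.md`; kit job j265670.
-/

set_option linter.dupNamespace false -- mandated namespace of this single-conjunct summit

namespace Summit.ResolutionOfSingularities.ResolutionOfSingularities.Theorems.CampaignW35K35ExceptionalTopLocus

open MvPolynomial
open Summit.ResolutionOfSingularities.ResolutionOfSingularities.Theorems.CampaignW32WQTopLocus (fW2 gammaW)

variable {R : Type*} [CommRing R]

/-! ## §1 The `y`-chart of the blow-up at the origin and the transform `fW1` -/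

/-- `H1 = w₁v₁⁶ + y(z₁w₁⁵v₁² + z₁²w₁v₁⁴) + y²(z₁³w₁⁵ + z₁w₁²v₁²) + y³z₁⁹ + y⁴` (so that `fW(x₁y,y,z₁y,w₁y,v₁y) = y²(x₁² + y⁵H1)`).
[OURS · L1 W3.5] -/
noncomputable def H1 : MvPolynomial (Fin 5) R :=
  X 3 * X 4 ^ 6 + X 1 * (X 2 * X 3 ^ 5 * X 4 ^ 2 + X 2 ^ 2 * X 3 * X 4 ^ 4)
    + X 1 ^ 2 * (X 2 ^ 3 * X 3 ^ 5 + X 2 * X 3 ^ 2 * X 4 ^ 2) + X 1 ^ 3 * X 2 ^ 9 + X 1 ^ 4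

/-- The transform `fW1 = x₁² + y⁵·H1` of `fW` in the `y`-chart of the blow-up at `0` (exceptional divisor `y = 0`, exceptional
exponent `5`). [OURS · L1 W3.5] -/
noncomputable def fW1 : MvPolynomial (Fin 5) R := X 0 ^ 2 + X 1 ^ 5 * H1

/-- The `y`-chart substitution `x = x₁y, y = y, z = z₁y, w = w₁y, v = v₁y`. [folklore] -/
noncomputable def chartY : MvPolynomial (Fin 5) R →ₐ[R] MvPolynomial (Fin 5) R :=
  bind₁ ![X 0 * X 1, X 1, X 2 * X 1, X 3 * X 1, X 4 * X 1]

/-- TRANSFORM IDENTITY (Def. 2.1 shape): `fW(x₁y, y, z₁y, w₁y, v₁y) = y² · fW1`. [OURS · L1 W3.5] -/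
theorem chartY_fW2 : chartY (fW2 : MvPolynomial (Fin 5) R) = X 1 ^ 2 * fW1 := by
  simp only [chartY, fW2, fW1, H1, map_add, map_mul, map_pow, bind₁_X_right, Matrix.cons_val_zero, Matrix.cons_val_one,
    Matrix.cons_val]
  ring

/-! ## §2 First partials of `fW1`: tangential triviality of the exceptional hyperplane `{y = x₁ = 0}` -/

/-- `H1` does not involve `x₁`. [folklore] -/
theorem pderiv0_H1 : pderiv 0 (H1 : MvPolynomial (Fin 5) R) = 0 := by
  simp only [H1]
  simp [Derivation.leibniz, Derivation.leibniz_pow, pderiv_X, smul_eq_mul]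

/-- `∂_{x₁} fW1 = 2x₁` (zero in characteristic 2). [OURS · L1 W3.5] -/
theorem pderiv0_fW1 : pderiv 0 (fW1 : MvPolynomial (Fin 5) R) = 2 * X 0 := by
  have h := (pderiv0_H1 (R := R))
  simp only [fW1, map_add, Derivation.leibniz, Derivation.leibniz_pow, pderiv_X, smul_eq_mul, h]
  simp

/-- `∂_y fW1 = y⁴ · (5·H1 + y·∂_y H1)`. [OURS · L1 W3.5] -/
theorem pderiv1_fW1 : pderiv 1 (fW1 : MvPolynomial (Fin 5) R) = X 1 ^ 4 * (5 * H1 + X 1 * pderiv 1 H1) := by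
  simp only [fW1, map_add, Derivation.leibniz, Derivation.leibniz_pow, pderiv_X, smul_eq_mul]
  simp
  ring

/-- `∂_{z₁} fW1 = y⁵ · ∂_{z₁} H1`. [OURS · L1 W3.5] -/
theorem pderiv2_fW1 : pderiv 2 (fW1 : MvPolynomial (Fin 5) R) = X 1 ^ 5 * pderiv 2 H1 := by
  simp only [fW1, map_add, Derivation.leibniz, Derivation.leibniz_pow, pderiv_X, smul_eq_mul]
  simp

/-- `∂_{w₁} fW1 = y⁵ · ∂_{w₁} H1`. [OURS · L1 W3.5] -/
theorem pderiv3_fW1 : pderiv 3 (fW1 : MvPolynomial (Fin 5) R) = X 1 ^ 5 * pderiv 3 H1 := by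
  simp only [fW1, map_add, Derivation.leibniz, Derivation.leibniz_pow, pderiv_X, smul_eq_mul]
  simp

/-- `∂_{v₁} fW1 = y⁵ · ∂_{v₁} H1`. [OURS · L1 W3.5] -/
theorem pderiv4_fW1 : pderiv 4 (fW1 : MvPolynomial (Fin 5) R) = X 1 ^ 5 * pderiv 4 H1 := by
  simp only [fW1, map_add, Derivation.leibniz, Derivation.leibniz_pow, pderiv_X, smul_eq_mul]
  simp

/-- `∂_y fW1 ∈ (y⁴)`. [OURS · L1 W3.5] -/
theorem pderiv1_fW1_mem : pderiv 1 (fW1 : MvPolynomial (Fin 5) R) ∈ Ideal.span {(X 1 ^ 4 : MvPolynomial (Fin 5) R)} :=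
  Ideal.mem_span_singleton'.mpr ⟨5 * H1 + X 1 * pderiv 1 H1, by rw [pderiv1_fW1]; ring⟩
/-- `∂_{z₁} fW1 ∈ (y⁴)`. [OURS · L1 W3.5] -/
theorem pderiv2_fW1_mem : pderiv 2 (fW1 : MvPolynomial (Fin 5) R) ∈ Ideal.span {(X 1 ^ 4 : MvPolynomial (Fin 5) R)} :=
  Ideal.mem_span_singleton'.mpr ⟨X 1 * pderiv 2 H1, by rw [pderiv2_fW1]; ring⟩
/-- `∂_{w₁} fW1 ∈ (y⁴)`. [OURS · L1 W3.5] -/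
theorem pderiv3_fW1_mem : pderiv 3 (fW1 : MvPolynomial (Fin 5) R) ∈ Ideal.span {(X 1 ^ 4 : MvPolynomial (Fin 5) R)} :=
  Ideal.mem_span_singleton'.mpr ⟨X 1 * pderiv 3 H1, by rw [pderiv3_fW1]; ring⟩
/-- `∂_{v₁} fW1 ∈ (y⁴)`. [OURS · L1 W3.5] -/
theorem pderiv4_fW1_mem : pderiv 4 (fW1 : MvPolynomial (Fin 5) R) ∈ Ideal.span {(X 1 ^ 4 : MvPolynomial (Fin 5) R)} :=
  Ideal.mem_span_singleton'.mpr ⟨X 1 * pderiv 4 H1, by rw [pderiv4_fW1]; ring⟩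

/-- Hence every first partial in a direction other than `x₁` is a multiple of `y⁴`: at each point of the exceptional hyperplane
`{y = x₁ = 0}` it has order `≥ 4 ≥ 2` (tangential triviality, report §3 (i)/§4). [OURS · L1 W3.5] -/
theorem pderiv_fW1_mem_span_y4 (i : Fin 5) (hi : i ≠ 0) :
    pderiv i (fW1 : MvPolynomial (Fin 5) R) ∈ Ideal.span {(X 1 ^ 4 : MvPolynomial (Fin 5) R)} := by
  match i, hi with
  | ⟨0, _⟩, hi => exact absurd rfl hi
  | ⟨1, _⟩, _ => exact pderiv1_fW1_mem
  | ⟨2, _⟩, _ => exact pderiv2_fW1_mem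
  | ⟨3, _⟩, _ => exact pderiv3_fW1_mem
  | ⟨4, _⟩, _ => exact pderiv4_fW1_mem

/-- `fW1 − x₁²` is a multiple of `y⁵` (exceptional exponent `a₁ = 5 ≥ 2`: every point of `{y = x₁ = 0}` is an order-2 point of
`fW1`). [OURS · L1 W3.5] -/
theorem fW1_sub_sq_mem_span_y5 : (fW1 : MvPolynomial (Fin 5) R) - X 0 ^ 2 ∈ Ideal.span {(X 1 ^ 5 : MvPolynomial (Fin 5) R)} := by
  rw [Ideal.mem_span_singleton']
  exact ⟨H1, by simp only [fW1]; ring⟩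

/-! ## §3 The lifted curve `γ′(s) = (s⁸¹, s¹⁸, s², s⁶, s¹¹)` (the parameter is the variable `X 0` of the target) -/

/-- `γ′(s) = (s⁸¹, s¹⁸, s², s⁶, s¹¹)`. [OURS · L1 W3.5] -/
noncomputable def gammaW1 : MvPolynomial (Fin 5) R →ₐ[R] MvPolynomial (Fin 5) R :=
  bind₁ ![X 0 ^ 81, X 0 ^ 18, X 0 ^ 2, X 0 ^ 6, X 0 ^ 11]

/-- `γ′` LIFTS `γ`: composing with the chart gives `γ(s) = (s⁹⁹, s¹⁸, s²⁰, s²⁴, s²⁹)` coordinate by coordinate. [OURS · L1 W3.5] -/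
theorem gammaW1_chartY (i : Fin 5) :
    gammaW1 (chartY (X i : MvPolynomial (Fin 5) R)) = gammaW (X i) := by
  fin_cases i <;>
    simp [gammaW1, chartY, gammaW, bind₁_X_right, Matrix.cons_val_zero, Matrix.cons_val_one, Matrix.cons_val] <;> ring

/-- `fW1(γ′(s)) = 8·s¹⁶²` (`= 0` in characteristic 2: `γ′ ⊂ V(fW1)`). [OURS · L1 W3.5] -/
theorem gammaW1_fW1 : gammaW1 (fW1 : MvPolynomial (Fin 5) R) = 8 * X 0 ^ 162 := by
  simp only [gammaW1, fW1, H1, map_add, map_mul, map_pow, bind₁_X_right, Matrix.cons_val_zero, Matrix.cons_val_one,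
    Matrix.cons_val]
  ring

/-- `H1(γ′(s)) = 7·s⁷²` (so `y⁵H1 = 7·s¹⁶²` against `x₁² = s¹⁶²`: the order of `fW1 − x₁²` at `q₁ = γ′(0)` along `γ′` is `162 = 2·81`).
[OURS · L1 W3.5] -/
theorem gammaW1_H1 : gammaW1 (H1 : MvPolynomial (Fin 5) R) = 7 * X 0 ^ 72 := by
  simp only [gammaW1, H1, map_add, map_mul, map_pow, bind₁_X_right, Matrix.cons_val_zero, Matrix.cons_val_one,
    Matrix.cons_val]
  ring

/-! ## §4 The local form at the generic point `(0, 0, a, b, c)` of the exceptional hyperplane -/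

/-- `H1(0, 0, a, b, c) = b·c⁶`: the value of `H1` at the exceptional point `q = (0,0,a,b,c)` — so `fW1 = x₁² + y⁵(bc⁶ + …)` near `q`,
degree-5 component `bc⁶·y⁵`. [OURS · L1 W3.5] -/
theorem eval_H1_excPoint (a b c : R) : eval ![0, 0, a, b, c] (H1 : MvPolynomial (Fin 5) R) = b * c ^ 6 := by
  simp [H1, Matrix.cons_val_zero, Matrix.cons_val_one, Matrix.cons_val]

/-- `(5·H1 + y·∂_yH1)(0, 0, a, b, c) = 5·b·c⁶`: by `pderiv1_fW1`, `∂_y fW1 = y⁴·(5bc⁶ + …)` near `q` — order exactly `4` where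
`5bc⁶` is a unit (in characteristic 2: where `bc ≠ 0`). [OURS · L1 W3.5] -/
theorem eval_K1_excPoint (a b c : R) :
    eval ![0, 0, a, b, c] (5 * H1 + X 1 * pderiv 1 H1 : MvPolynomial (Fin 5) R) = 5 * (b * c ^ 6) := by
  simp [H1, Matrix.cons_val_zero, Matrix.cons_val_one, Matrix.cons_val]

/-- `fW1(0, 0, a, b, c) = 0`: every point of the exceptional hyperplane `{x₁ = y = 0}` lies on `V(fW1)` (with §2: in its order-2
locus). [OURS · L1 W3.5] -/
theorem eval_fW1_excPoint (a b c : R) : eval ![0, 0, a, b, c] (fW1 : MvPolynomial (Fin 5) R) = 0 := by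
  simp [fW1, H1, Matrix.cons_val_zero, Matrix.cons_val_one, Matrix.cons_val]

end Summit.ResolutionOfSingularities.ResolutionOfSingularities.Theorems.CampaignW35K35ExceptionalTopLocus
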